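import Literature.MathematicalPhysics.QuantumFieldTheory.Balaban1983to89.B9Eq3152StoreyHClosedOnModel
import Literature.MathematicalPhysics.QuantumFieldTheory.Balaban1983to89.B9Eq347H1kPiSupGradGlobal
import Literature.MathematicalPhysics.QuantumFieldTheory.Balaban1983to89.B11Eq117ReadLettersBridge

/-!
# `Balaban1983to89.B11Eq117ChartLettersOnModel` — T. Bałaban, *The variational problem and background fields in renormalization group method for lattice gauge
# theories*, Commun. Math. Phys. **102** (1985) 277–309 [Balaban1985Variational] (117) p. 295 *«By Theorem 3.13 of [5] the norm max{|·|_{(−1)}, |∇·|_{(−2)}} of the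
# transformation can be estimated by B₀|J|_{(−3)} + …»*, (103) p. 293, (174) p. 305 (the chart's letters `𝔊`, `H₁`), with [5] = [Balaban1985BackgroundPropagators] Thm 3.13
# p. 426, Thm 3.12 p. 423, Thm 3.1 (3.47) p. 398: **THE (117) AND (103) SOCKETS IN THE CHART's OWN CURRENCY ON THE CELL's MODEL — the operator norms of the chart letters
# `𝔊̃_k = frakGLatticeCLM φ hposπ hQ lev₁ (nabla115 η U)` and `H̃_{1,k} = H1LatticeCLM φ hposπ hQ lev₁ (nabla115 η U)` (print's operator (3.122), the space (115) over `𝔸`)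
# are bounded by `max(w̄₀, w̄₁)·M_φBM_φ′·w̲⁻¹` with ONE `B` FIXED BEFORE the height `n`, the spacing, the period `m` and the background** — from STOREY H CLOSED (this
# lineage's X12 `B9Eq3152StoreyHClosedOnModel.local_gradLetter_thirdWord_holds` fed to G-3 §2 `B11Eq117FrakGkPiTransformationNorm.exists_global_supGrad_frakGLatticeKPi_of_thirdWord`),
# (I-1) `B9Eq347H1kPiSupGradGlobal.exists_global_supGrad_H1LatticeKPi`, and the carrier bridge (I-3) `B11Eq117ReadLettersBridge`.  These two operator norms are the ONLY
# lattice-dependent inputs of the k-level `cur U` chart `Support/NE9CurChartTowerPiUniformBall` (there: `C·V_G`, `C·V_H` with (117)'s volume ∕ `2|η|⁻¹` products displayed —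
# WALL-NE9-P1 v1.14.20 «the k-level chart's residual non-uniformity is (117)'s displayed product ONLY»); STOREY I of the (117)∕(103) programme

statement-level skeleton of published theorems with citation tags; proofs where landed; nothing here is a claim about the Yang–Mills mass gap

CITATION HEADER (lean-in-tree rule).  Audit cell `pub-balaban`, sub-cell `t4`, BINDER row NE9; NE9 crux-team LEAF PROVER 01 (`b2b-balaban-t4-ne9-formalise-leaf-01`, gen 96;
(I-4); bears_on: R4/N22).  Composed BY NAME, nothing restated: X12 §2, G-3 §2, (I-1), (I-3) `norm_frakGLatticeCLM_le_of_global` ∕ `norm_H1LatticeCLM_le_of_global`.  Sources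
read through the audited headers of X12 ∕ G-3 (`paper:balaban1985-cmp102-variational-background` p. 293 (103), p. 295 (117), p. 305 (174); `paper:balaban1985-cmp99-background-propagators`
p. 398 (3.47), p. 423 Thm 3.12, p. 426 Thm 3.13).  NOTHING of print's proof is reproduced; no constant of print is valued.

WHAT IS PROVED (sorry-free; proof lane — 0 `def`; [folklore] composition BY NAME).
* §1 **`exists_norm_frakGLatticeCLM_le`** — `∃ α₁ j₁ B` (`0 < α₁`, `0 < j₁`, `0 ≤ B`) BEFORE the (K86)∕G-3 binder block VERBATIM through `hQ`, then for ANY parameters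
  `(Lw, ηw)` and level maps `lev₀, lev₁` of (115): `‖frakGLatticeCLM φ hposπ hQ lev₁ (nabla115 η U)‖ ≤ max(w̄₀·M_φBM_φ′, w̄₁·M_φBM_φ′)·w̲₃⁻¹` — the (117) socket X12 moved
  into the chart's type `NegSize Lw ηw lev₀ 3 𝔸 →L Space115 Lw ηw lev₀ lev₁ (nabla115 η U)`.
* §2 **`exists_norm_H1LatticeCLM_le`** — the same for `H̃_{1,k}`: `‖H1LatticeCLM φ hposπ hQ lev₁ (nabla115 η U)‖ ≤ max(w̄₀·M_φBM_φ′, w̄₁·M_φBM_φ′)·w̲_B⁻¹`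
  (`w̲_B⁻¹ = wInvSup (levWeight Lw ηw levB 0)`), the (103)∕(46) socket.
* §3 **`exists_norm_chartLetters_le`** — both at ONE `(α₁, j₁, B)`.
HONEST SCOPE.  Everything is on the cell's MODEL of [B9]∕[B11] (tower `towerP`, transporters `Ad(U)`, `laplacePrimeAk`, `laplaceAk`, `laplaceAkPi`, `frakGLatticeK`, `H1LatticeK`);
the binder block's smallness data (`α ≤ α₁`, `‖J‖ ≤ j₀ ≤ j₁`, per-level data with `Σ αU ≤ AQ`, positivity witnesses, `Q_k` surjective) are HYPOTHESES as in X12; the (115)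
weights stay symbolic; `B` crude, NOT print's `B₀`; nothing of [B11] (103)∕(117) or [B9] Thms 3.12∕3.13 on print's objects is asserted.  «NE9 ⇐ the named binders»; NE9 NOT
PRINTED ∕ NOT PROVED; row WALLED ON A MODEL (O-NE9-1; #5 UNRULED); spine PROVED 0∕9; rung (B)+1 on a finite T⁴ — NOT infinite volume, NOT mass gap, NOT BetaPertH, NOT Clay.
HONEST DEPENDENCY: continuum YM on T⁴ ⇐ BetaPertH ∧ nine spine estimates (0/9 proved); BetaPertH ⇐ (D1) ∧ (D4) ∧ CAP+tail; G-an2-4 gates asym, D1 and NE2/3/4.  NEW file;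
nothing modified.  Net new unproved facts: 0.
-/

noncomputable section

set_option autoImplicit false

open scoped InnerProductSpace ComplexConjugate BigOperators

namespace Literature.MathematicalPhysics.QuantumFieldTheory.Balaban1983to89.B11Eq117ChartLettersOnModel

open B4Sect5Torus (TSite tdist)
open B9SectCLatticeCarrier (Bond bpos btgt unshift)
open B9Eq311L2Pairing (WL2)
open B9Eq33CovDerivVector (covGrad)
open B7Prop1Explicit (U1 Wcx boxVec)
open B11Eq103H1Complex (SiteL2K BondL2K covDerivL2K G1LatticeK H1LatticeK frakGLatticeK H1LatticeCLM frakGLatticeCLM)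
open B9Eq310DeltaPrime (plaqHolU)
open B9Eq310HessianOperator (adTransportW)
open B9Eq315QTorus (perCfg cornerSite)
open B9Eq315QTower (towerP UlevOf)
open B9Eq326OperatorTower (QkW laplaceAk)
open B9Eq3119DeltaPiTower (laplaceAkPi)
open B9Eq324DeltaPrimeATower (laplacePrimeAk)
open B11Eq115Space (NegSup levWeight)
open B11Eq111FrakG (nabla115)
open B9Eq3152StoreyHClosedOnModel (local_gradLetter_thirdWord_holds)
open B11Eq117FrakGkPiTransformationNorm (exists_global_supGrad_frakGLatticeKPi_of_thirdWord)
open B9Eq347H1kPiSupGradGlobal (exists_global_supGrad_H1LatticeKPi)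
open B11Eq117ReadLettersBridge (norm_frakGLatticeCLM_le_of_global norm_H1LatticeCLM_le_of_global)

variable {d : ℕ} (hd : 1 ≤ d) (L : ℕ) [NeZero L] (hL : 1 ≤ L) (hL3 : 3 ≤ L)
  {𝔸 : Type*} [NormedRing 𝔸] [NormedAlgebra ℂ 𝔸] [CompleteSpace 𝔸] [NormOneClass 𝔸] [StarRing 𝔸] [NormedStarGroup 𝔸] [StarModule ℂ 𝔸] [FiniteDimensional ℂ 𝔸]
  {W : Type*} [NormedAddCommGroup W] [InnerProductSpace ℂ W] [FiniteDimensional ℂ W] (φ : W ≃ₗ[ℂ] 𝔸)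
  {Mφ Mφ' : ℝ} (hMφ : 0 ≤ Mφ) (hMφ' : 0 ≤ Mφ') (hφ : ∀ w, ‖φ w‖ ≤ Mφ * ‖w‖) (hφ' : ∀ X, ‖φ.symm X‖ ≤ Mφ' * ‖X‖) (hstar : ∀ X : 𝔸, ‖star X‖ ≤ ‖X‖)
  {a : ℝ} (ha : 0 < a) {a' : ℝ} (ha' : 0 < a') {ϱ : ℝ} (hϱ0 : 0 ≤ ϱ) (hϱ1 : ϱ < 1)
  (τ : 𝔸 →ₗ[ℂ] ℂ) {Cτ : ℝ} (hτ : ∀ X, ‖τ X‖ ≤ Cτ * ‖X‖) (hCτ : 0 ≤ Cτ) {Mτ : ℝ} (hτm : ∀ X Y : 𝔸, ‖τ (X * Y)‖ ≤ Mτ * ‖X‖ * ‖Y‖) (hMτ : 0 ≤ Mτ)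
  {ρw : ℝ} (hρw : 0 ≤ ρw)
  (hτ₁ : ∀ X : 𝔸, τ (star X) = conj (τ X)) (hτ₂ : ∀ X Y : 𝔸, τ (X * Y) = τ (Y * X)) (hφτ : ∀ X Y : 𝔸, ⟪φ.symm X, φ.symm Y⟫_ℂ = τ (star X * Y))
  (AQ : ℝ)

/-! ## §1 The (117) socket in the chart's currency -/

set_option maxRecDepth 8192 in -- deep definitional unfolding `laplaceAkPi` ↦ `laplaceALatticeK …` in the statement (as `Support/NE9CurChartTowerPiUniformBall`)
set_option maxHeartbeats 800000 in -- two ≈ 50-binder blocks (as X12 §3)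
include hd hL hL3 hMφ hMφ' hφ hφ' hstar ha ha' hϱ0 hϱ1 hτ hCτ hτm hMτ hρw hτ₁ hτ₂ hφτ in
/-- **THE (117) SOCKET IN THE CHART's CURRENCY ON THE MODEL**: one `(α₁, j₁, B)` BEFORE the height, the spacing on the diagonal, the period and the background such that
`‖frakGLatticeCLM φ hposπ hQ lev₁ (nabla115 η U)‖ ≤ max(w̄₀·M_φBM_φ′, w̄₁·M_φBM_φ′)·w̲₃⁻¹` for the FULL `𝔊̃_k` of print's operator (3.122) in the space (115) over `𝔸`, for any
`(Lw, ηw, lev₀, lev₁)` — X12 ∕ G-3 §2 through the carrier bridge (I-3).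
[cite: Balaban1985Variational, (117) p.295, (174) p.305; Balaban1985BackgroundPropagators, Thm 3.13 p.426, Thm 3.1 (3.47) p.398] -/
theorem exists_norm_frakGLatticeCLM_le :
    ∃ α₁ j₁ B : ℝ, 0 < α₁ ∧ 0 < j₁ ∧ 0 ≤ B ∧
      ∀ (n : ℕ) (η : ℝ) (_hηL : η * (L : ℝ) ^ (n + 1) = 1) (c₀ c₁ : ℝ) [Fact (0 < c₀)] [Fact (0 < c₁)]
        (_hw : c₀ * ((L : ℝ) ^ (n + 1)) ^ d = c₁) (_hρ : |η| ^ d / c₀ ≤ ρw) (m : Fin d → ℕ) [∀ i, NeZero (m i)] (_hm : ∀ i, 1 ≤ m i)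
        (U : Bond d (towerP L m (n + 1)) → 𝔸ˣ) (αU : ℕ → ℝ) (_hα0 : ∀ j, 0 ≤ αU j) (hα1 : ∀ j, αU j ≤ 1 / 64)
        (hαL : ∀ j, 50 * (d + 1) * αU j * (L : ℝ) ^ d ≤ 1 / 2)
        (hU1 : ∀ (j : ℕ) (x : B7Prop1Explicit.Site d) (k : Fin d), perCfg (towerP L m (j + 1)) (UlevOf L m (n + 1) U j) x k ∈ U1 𝔸)
        (hreg : ∀ (j : ℕ) (y : TSite d (towerP L m j)) (k : Fin d) (ρ' : Fin d → Fin L),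
          ‖((Wcx L (perCfg (towerP L m (j + 1)) (UlevOf L m (n + 1) U j)) (cornerSite L y) k (boxVec L ρ') : 𝔸ˣ) : 𝔸) - 1‖ ≤ αU j)
        (εU : ℕ → ℝ) (_hεU : ∀ j, 0 ≤ εU j) (_hUε : ∀ (j : ℕ) (b : Bond d (towerP L m (j + 1))), ‖(UlevOf L m (n + 1) U j b : 𝔸) - 1‖ ≤ εU j)
        (_hLb : ∀ (j : ℕ) (b : Bond d (towerP L m (j + 1))), UlevOf L m (n + 1) U j b ∈ U1 𝔸)
        (α : ℝ) (_hα : 0 ≤ α) (_hαle : α ≤ α₁)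
        (hUst : ∀ b, star (U b : 𝔸) = (((U b)⁻¹ : 𝔸ˣ) : 𝔸)) (_hUb : ∀ b, U b ∈ U1 𝔸) (_hUη : ∀ b, ‖(U b : 𝔸) - 1‖ ≤ α * η)
        (_hpl : ∀ p : B9SectCLatticeCarrier.Plaq d (towerP L m (n + 1)), ‖(plaqHolU U p : 𝔸) - 1‖ ≤ α * η ^ 2)
        (_hUgrad : ∀ (x : TSite d (towerP L m (n + 1))) (μ : Fin d), ‖(U (x, μ) : 𝔸) - U (unshift μ x, μ)‖ ≤ α * η ^ 2)
        (_hRlev : ∀ (j : ℕ) (b : Bond d (towerP L m (j + 1))) (w : W), ‖adTransportW φ (UlevOf L m (n + 1) U j) b w‖ ≤ ‖w‖)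
        (_hεg : ∀ j < n + 1, εU j ≤ α * ϱ ^ j) (_hAQ : ∑ j ∈ Finset.range (n + 1), αU j ≤ AQ)
        (hpos' : ∀ x : SiteL2K ℂ d (towerP L m (n + 1)) c₀ W, x ≠ 0 → 0 < RCLike.re ⟪x, laplacePrimeAk L m n φ η U a' (c₁ := c₁) x⟫_ℂ)
        (hpos : ∀ x : BondL2K ℂ d (towerP L m (n + 1)) c₀ W, x ≠ 0 →
          0 < RCLike.re ⟪x, laplaceAk L m n φ η U hL αU hα1 hU1 hreg τ (c₀ := c₀) (c₁ := c₁) a x⟫_ℂ)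
        (_hc₀η : c₀ = η ^ d) (j₀ : ℝ) (_hJ : ∀ μ y, ‖B9Eq39Adjoint.J (fun μ => B9Eq33CovDerivVector.shiftEquiv μ) (fun μ y => U (y, μ)) η μ y‖ ≤ j₀) (_hj : j₀ ≤ j₁)
        (hposπ : ∀ x : BondL2K ℂ d (towerP L m (n + 1)) c₀ W, x ≠ 0 →
          0 < RCLike.re ⟪x, laplaceAkPi L m n φ τ η U a' hpos' hL αU hα1 hU1 hreg (c₁ := c₁) a x⟫_ℂ)
        (hQ : Function.Surjective (QkW L m n φ U hL αU hα1 hU1 hreg (c₀ := c₀) (c₁ := c₁)))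
        (Lw ηw : ℝ) [Fact (0 < Lw)] [Fact (0 < ηw)] (lev₀ : Bond d (towerP L m (n + 1)) → ℕ) (lev₁ : Bond d (towerP L m (n + 1)) × Fin d → ℕ),
        ‖frakGLatticeCLM (L := Lw) (η := ηw) (lev₀ := lev₀) φ hposπ hQ lev₁ (nabla115 η U)‖ ≤
          max ((NegSup.wSup (levWeight Lw ηw lev₀ 1) : ℝ) * (Mφ * B * Mφ')) (NegSup.wSup (levWeight Lw ηw lev₁ 2) * (Mφ * B * Mφ')) *
            NegSup.wInvSup (levWeight Lw ηw lev₀ 3) := by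
  obtain ⟨α₁, j₁, B, hα₁, hj₁, hB, HG⟩ :=
    exists_global_supGrad_frakGLatticeKPi_of_thirdWord hd L hL hL3 φ hMφ hMφ' hφ hφ' hstar ha ha' hϱ0 hϱ1 τ hτ hCτ hτm hMτ hρw hτ₁ hτ₂ hφτ AQ
      (local_gradLetter_thirdWord_holds hd L hL hL3 φ hMφ hMφ' hφ hφ' ha ha' hϱ0 hϱ1 τ hτ hCτ hMτ hρw hτ₁ hτ₂ hφτ AQ)
  refine ⟨α₁, j₁, B, hα₁, hj₁, hB, ?_⟩
  intro n η hηL c₀ c₁ _ _ hw hρ m _ hm U αU hα0 hα1 hαL hU1 hreg εU hεU hUε hLb α hα hαle hUst hUb hUη hpl hUgrad hRlev hεg hAQ hpos' hpos hc₀η j₀ hJ hj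
    hposπ hQ Lw ηw _ _ lev₀ lev₁
  have H := HG n η hηL c₀ c₁ hw hρ m hm U αU hα0 hα1 hαL hU1 hreg εU hεU hUε hLb α hα hαle hUst hUb hUη hpl hUgrad hRlev hεg hAQ hpos' hpos hc₀η j₀ hJ hj
    hposπ hQ
  exact norm_frakGLatticeCLM_le_of_global φ hposπ hQ hMφ hφ hMφ' hφ' η U lev₁ hB hB
    (fun z M hM hzM x => (H z M hM hzM ⟨0, hd⟩ x).1) (fun z M hM hzM p => (H z M hM hzM p.2 p.1).2.2)

/-! ## §2 The (103) socket in the chart's currency -/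

set_option maxRecDepth 8192 in -- deep definitional unfolding `laplaceAkPi` ↦ `laplaceALatticeK …` in the statement
set_option maxHeartbeats 800000 in -- two ≈ 50-binder blocks
include hd hL hL3 hMφ hMφ' hφ hφ' hstar ha ha' hϱ0 hϱ1 hτ hCτ hτm hMτ hρw hτ₁ hτ₂ hφτ in
/-- **THE (103)∕(46) SOCKET IN THE CHART's CURRENCY ON THE MODEL**: one `(α₁, j₁, B)` BEFORE the height, the spacing on the diagonal, the period and the background such
that `‖H1LatticeCLM φ hposπ hQ lev₁ (nabla115 η U)‖ ≤ max(w̄₀·M_φBM_φ′, w̄₁·M_φBM_φ′)·w̲_B⁻¹` for `H̃_{1,k} = G̃_kQ_k†(Q_kG̃_kQ_k†)⁻¹` of print's operator (3.122), block fields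
`|·|_{(−0)}` on the coarse bonds to the space (115) over `𝔸`, for any `(Lw, ηw, lev₀, lev₁, levB)` — (I-1) through the carrier bridge (I-3).
[cite: Balaban1985Variational, (103) p.293, (46) p.285, (174) p.305; Balaban1985BackgroundPropagators, Thm 3.12 p.423, Thm 3.1 (3.47) p.398, (3.126) p.420] -/
theorem exists_norm_H1LatticeCLM_le :
    ∃ α₁ j₁ B : ℝ, 0 < α₁ ∧ 0 < j₁ ∧ 0 ≤ B ∧
      ∀ (n : ℕ) (η : ℝ) (_hηL : η * (L : ℝ) ^ (n + 1) = 1) (c₀ c₁ : ℝ) [Fact (0 < c₀)] [Fact (0 < c₁)]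
        (_hw : c₀ * ((L : ℝ) ^ (n + 1)) ^ d = c₁) (_hρ : |η| ^ d / c₀ ≤ ρw) (m : Fin d → ℕ) [∀ i, NeZero (m i)] (_hm : ∀ i, 1 ≤ m i)
        (U : Bond d (towerP L m (n + 1)) → 𝔸ˣ) (αU : ℕ → ℝ) (_hα0 : ∀ j, 0 ≤ αU j) (hα1 : ∀ j, αU j ≤ 1 / 64)
        (hαL : ∀ j, 50 * (d + 1) * αU j * (L : ℝ) ^ d ≤ 1 / 2)
        (hU1 : ∀ (j : ℕ) (x : B7Prop1Explicit.Site d) (k : Fin d), perCfg (towerP L m (j + 1)) (UlevOf L m (n + 1) U j) x k ∈ U1 𝔸)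
        (hreg : ∀ (j : ℕ) (y : TSite d (towerP L m j)) (k : Fin d) (ρ' : Fin d → Fin L),
          ‖((Wcx L (perCfg (towerP L m (j + 1)) (UlevOf L m (n + 1) U j)) (cornerSite L y) k (boxVec L ρ') : 𝔸ˣ) : 𝔸) - 1‖ ≤ αU j)
        (εU : ℕ → ℝ) (_hεU : ∀ j, 0 ≤ εU j) (_hUε : ∀ (j : ℕ) (b : Bond d (towerP L m (j + 1))), ‖(UlevOf L m (n + 1) U j b : 𝔸) - 1‖ ≤ εU j)
        (_hLb : ∀ (j : ℕ) (b : Bond d (towerP L m (j + 1))), UlevOf L m (n + 1) U j b ∈ U1 𝔸)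
        (α : ℝ) (_hα : 0 ≤ α) (_hαle : α ≤ α₁)
        (hUst : ∀ b, star (U b : 𝔸) = (((U b)⁻¹ : 𝔸ˣ) : 𝔸)) (_hUb : ∀ b, U b ∈ U1 𝔸) (_hUη : ∀ b, ‖(U b : 𝔸) - 1‖ ≤ α * η)
        (_hpl : ∀ p : B9SectCLatticeCarrier.Plaq d (towerP L m (n + 1)), ‖(plaqHolU U p : 𝔸) - 1‖ ≤ α * η ^ 2)
        (_hUgrad : ∀ (x : TSite d (towerP L m (n + 1))) (μ : Fin d), ‖(U (x, μ) : 𝔸) - U (unshift μ x, μ)‖ ≤ α * η ^ 2)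
        (_hRlev : ∀ (j : ℕ) (b : Bond d (towerP L m (j + 1))) (w : W), ‖adTransportW φ (UlevOf L m (n + 1) U j) b w‖ ≤ ‖w‖)
        (_hεg : ∀ j < n + 1, εU j ≤ α * ϱ ^ j) (_hAQ : ∑ j ∈ Finset.range (n + 1), αU j ≤ AQ)
        (hpos' : ∀ x : SiteL2K ℂ d (towerP L m (n + 1)) c₀ W, x ≠ 0 → 0 < RCLike.re ⟪x, laplacePrimeAk L m n φ η U a' (c₁ := c₁) x⟫_ℂ)
        (hpos : ∀ x : BondL2K ℂ d (towerP L m (n + 1)) c₀ W, x ≠ 0 →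
          0 < RCLike.re ⟪x, laplaceAk L m n φ η U hL αU hα1 hU1 hreg τ (c₀ := c₀) (c₁ := c₁) a x⟫_ℂ)
        (_hc₀η : c₀ = η ^ d) (j₀ : ℝ) (_hJ : ∀ μ y, ‖B9Eq39Adjoint.J (fun μ => B9Eq33CovDerivVector.shiftEquiv μ) (fun μ y => U (y, μ)) η μ y‖ ≤ j₀) (_hj : j₀ ≤ j₁)
        (hposπ : ∀ x : BondL2K ℂ d (towerP L m (n + 1)) c₀ W, x ≠ 0 →
          0 < RCLike.re ⟪x, laplaceAkPi L m n φ τ η U a' hpos' hL αU hα1 hU1 hreg (c₁ := c₁) a x⟫_ℂ)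
        (hQ : Function.Surjective (QkW L m n φ U hL αU hα1 hU1 hreg (c₀ := c₀) (c₁ := c₁)))
        (Lw ηw : ℝ) [Fact (0 < Lw)] [Fact (0 < ηw)] (lev₀ : Bond d (towerP L m (n + 1)) → ℕ) (lev₁ : Bond d (towerP L m (n + 1)) × Fin d → ℕ)
        (levB : Bond d m → ℕ),
        ‖H1LatticeCLM (L := Lw) (η := ηw) (lev₀ := lev₀) (levB := levB) φ hposπ hQ lev₁ (nabla115 η U)‖ ≤
          max ((NegSup.wSup (levWeight Lw ηw lev₀ 1) : ℝ) * (Mφ * B * Mφ')) (NegSup.wSup (levWeight Lw ηw lev₁ 2) * (Mφ * B * Mφ')) *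
            NegSup.wInvSup (levWeight Lw ηw levB 0) := by
  obtain ⟨α₁, j₁, B, hα₁, hj₁, hB, HH⟩ :=
    exists_global_supGrad_H1LatticeKPi hd L hL hL3 φ hMφ hMφ' hφ hφ' hstar ha ha' hϱ0 hϱ1 τ hτ hCτ hτm hMτ hρw hτ₁ hτ₂ hφτ AQ
  refine ⟨α₁, j₁, B, hα₁, hj₁, hB, ?_⟩
  intro n η hηL c₀ c₁ _ _ hw hρ m _ hm U αU hα0 hα1 hαL hU1 hreg εU hεU hUε hLb α hα hαle hUst hUb hUη hpl hUgrad hRlev hεg hAQ hpos' hpos hc₀η j₀ hJ hj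
    hposπ hQ Lw ηw _ _ lev₀ lev₁ levB
  have H := HH n η hηL c₀ c₁ hw hρ m hm U αU hα0 hα1 hαL hU1 hreg εU hεU hUε hLb α hα hαle hUst hUb hUη hpl hUgrad hRlev hεg hAQ hpos' hpos hc₀η j₀ hJ hj
    hposπ hQ
  exact norm_H1LatticeCLM_le_of_global φ hposπ hQ hMφ hφ hMφ' hφ' η U lev₁ hB hB
    (fun z M hM hzM x => (H z M hM hzM ⟨0, hd⟩ x).1) (fun z M hM hzM p => (H z M hM hzM p.2 p.1).2.2)

/-! ## §3 Both chart letters at one `(α₁, j₁, B)` -/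

set_option maxRecDepth 8192 in -- deep definitional unfolding `laplaceAkPi` ↦ `laplaceALatticeK …` in the statement
set_option maxHeartbeats 800000 in -- two ≈ 50-binder blocks read twice
include hd hL hL3 hMφ hMφ' hφ hφ' hstar ha ha' hϱ0 hϱ1 hτ hCτ hτm hMτ hρw hτ₁ hτ₂ hφτ in
/-- **BOTH CHART LETTERS AT ONE `(α₁, j₁, B)` BEFORE THE LATTICE AND THE HEIGHT** — §1 ∧ §2 at `min ∕ min ∕ max`: the two operator norms that feed
`B11Eq118RegimeScalars.exists_twoRegimes_radii_of_bounds` in the k-level chart. [cite: Balaban1985Variational, (103) p.293, (117) p.295, Prop. 6 (118)–(121) p.295, (174) p.305] -/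
theorem exists_norm_chartLetters_le :
    ∃ α₁ j₁ B : ℝ, 0 < α₁ ∧ 0 < j₁ ∧ 0 ≤ B ∧
      ∀ (n : ℕ) (η : ℝ) (_hηL : η * (L : ℝ) ^ (n + 1) = 1) (c₀ c₁ : ℝ) [Fact (0 < c₀)] [Fact (0 < c₁)]
        (_hw : c₀ * ((L : ℝ) ^ (n + 1)) ^ d = c₁) (_hρ : |η| ^ d / c₀ ≤ ρw) (m : Fin d → ℕ) [∀ i, NeZero (m i)] (_hm : ∀ i, 1 ≤ m i)
        (U : Bond d (towerP L m (n + 1)) → 𝔸ˣ) (αU : ℕ → ℝ) (_hα0 : ∀ j, 0 ≤ αU j) (hα1 : ∀ j, αU j ≤ 1 / 64)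
        (hαL : ∀ j, 50 * (d + 1) * αU j * (L : ℝ) ^ d ≤ 1 / 2)
        (hU1 : ∀ (j : ℕ) (x : B7Prop1Explicit.Site d) (k : Fin d), perCfg (towerP L m (j + 1)) (UlevOf L m (n + 1) U j) x k ∈ U1 𝔸)
        (hreg : ∀ (j : ℕ) (y : TSite d (towerP L m j)) (k : Fin d) (ρ' : Fin d → Fin L),
          ‖((Wcx L (perCfg (towerP L m (j + 1)) (UlevOf L m (n + 1) U j)) (cornerSite L y) k (boxVec L ρ') : 𝔸ˣ) : 𝔸) - 1‖ ≤ αU j)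
        (εU : ℕ → ℝ) (_hεU : ∀ j, 0 ≤ εU j) (_hUε : ∀ (j : ℕ) (b : Bond d (towerP L m (j + 1))), ‖(UlevOf L m (n + 1) U j b : 𝔸) - 1‖ ≤ εU j)
        (_hLb : ∀ (j : ℕ) (b : Bond d (towerP L m (j + 1))), UlevOf L m (n + 1) U j b ∈ U1 𝔸)
        (α : ℝ) (_hα : 0 ≤ α) (_hαle : α ≤ α₁)
        (hUst : ∀ b, star (U b : 𝔸) = (((U b)⁻¹ : 𝔸ˣ) : 𝔸)) (_hUb : ∀ b, U b ∈ U1 𝔸) (_hUη : ∀ b, ‖(U b : 𝔸) - 1‖ ≤ α * η)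
        (_hpl : ∀ p : B9SectCLatticeCarrier.Plaq d (towerP L m (n + 1)), ‖(plaqHolU U p : 𝔸) - 1‖ ≤ α * η ^ 2)
        (_hUgrad : ∀ (x : TSite d (towerP L m (n + 1))) (μ : Fin d), ‖(U (x, μ) : 𝔸) - U (unshift μ x, μ)‖ ≤ α * η ^ 2)
        (_hRlev : ∀ (j : ℕ) (b : Bond d (towerP L m (j + 1))) (w : W), ‖adTransportW φ (UlevOf L m (n + 1) U j) b w‖ ≤ ‖w‖)
        (_hεg : ∀ j < n + 1, εU j ≤ α * ϱ ^ j) (_hAQ : ∑ j ∈ Finset.range (n + 1), αU j ≤ AQ)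
        (hpos' : ∀ x : SiteL2K ℂ d (towerP L m (n + 1)) c₀ W, x ≠ 0 → 0 < RCLike.re ⟪x, laplacePrimeAk L m n φ η U a' (c₁ := c₁) x⟫_ℂ)
        (hpos : ∀ x : BondL2K ℂ d (towerP L m (n + 1)) c₀ W, x ≠ 0 →
          0 < RCLike.re ⟪x, laplaceAk L m n φ η U hL αU hα1 hU1 hreg τ (c₀ := c₀) (c₁ := c₁) a x⟫_ℂ)
        (_hc₀η : c₀ = η ^ d) (j₀ : ℝ) (_hJ : ∀ μ y, ‖B9Eq39Adjoint.J (fun μ => B9Eq33CovDerivVector.shiftEquiv μ) (fun μ y => U (y, μ)) η μ y‖ ≤ j₀) (_hj : j₀ ≤ j₁)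
        (hposπ : ∀ x : BondL2K ℂ d (towerP L m (n + 1)) c₀ W, x ≠ 0 →
          0 < RCLike.re ⟪x, laplaceAkPi L m n φ τ η U a' hpos' hL αU hα1 hU1 hreg (c₁ := c₁) a x⟫_ℂ)
        (hQ : Function.Surjective (QkW L m n φ U hL αU hα1 hU1 hreg (c₀ := c₀) (c₁ := c₁)))
        (Lw ηw : ℝ) [Fact (0 < Lw)] [Fact (0 < ηw)] (lev₀ : Bond d (towerP L m (n + 1)) → ℕ) (lev₁ : Bond d (towerP L m (n + 1)) × Fin d → ℕ)
        (levB : Bond d m → ℕ),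
        ‖frakGLatticeCLM (L := Lw) (η := ηw) (lev₀ := lev₀) φ hposπ hQ lev₁ (nabla115 η U)‖ ≤
          max ((NegSup.wSup (levWeight Lw ηw lev₀ 1) : ℝ) * (Mφ * B * Mφ')) (NegSup.wSup (levWeight Lw ηw lev₁ 2) * (Mφ * B * Mφ')) *
            NegSup.wInvSup (levWeight Lw ηw lev₀ 3) ∧
        ‖H1LatticeCLM (L := Lw) (η := ηw) (lev₀ := lev₀) (levB := levB) φ hposπ hQ lev₁ (nabla115 η U)‖ ≤
          max ((NegSup.wSup (levWeight Lw ηw lev₀ 1) : ℝ) * (Mφ * B * Mφ')) (NegSup.wSup (levWeight Lw ηw lev₁ 2) * (Mφ * B * Mφ')) *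
            NegSup.wInvSup (levWeight Lw ηw levB 0) := by
  obtain ⟨αG, jG, BG, hαG, hjG, hBG, HG⟩ := exists_norm_frakGLatticeCLM_le hd L hL hL3 φ hMφ hMφ' hφ hφ' hstar ha ha' hϱ0 hϱ1 τ hτ hCτ hτm hMτ hρw hτ₁ hτ₂ hφτ AQ
  obtain ⟨αH, jH, BH, hαH, hjH, hBH, HH⟩ := exists_norm_H1LatticeCLM_le hd L hL hL3 φ hMφ hMφ' hφ hφ' hstar ha ha' hϱ0 hϱ1 τ hτ hCτ hτm hMτ hρw hτ₁ hτ₂ hφτ AQ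
  refine ⟨min αG αH, min jG jH, max BG BH, lt_min hαG hαH, lt_min hjG hjH, le_max_of_le_left hBG, ?_⟩
  intro n η hηL c₀ c₁ _ _ hw hρ m _ hm U αU hα0 hα1 hαL hU1 hreg εU hεU hUε hLb α hα hαle hUst hUb hUη hpl hUgrad hRlev hεg hAQ hpos' hpos hc₀η j₀ hJ hj
    hposπ hQ Lw ηw _ _ lev₀ lev₁ levB
  have hG := HG n η hηL c₀ c₁ hw hρ m hm U αU hα0 hα1 hαL hU1 hreg εU hεU hUε hLb α hα (hαle.trans (min_le_left _ _)) hUst hUb hUη hpl hUgrad hRlev hεg hAQ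
    hpos' hpos hc₀η j₀ hJ (hj.trans (min_le_left _ _)) hposπ hQ Lw ηw lev₀ lev₁
  have hH := HH n η hηL c₀ c₁ hw hρ m hm U αU hα0 hα1 hαL hU1 hreg εU hεU hUε hLb α hα (hαle.trans (min_le_right _ _)) hUst hUb hUη hpl hUgrad hRlev hεg hAQ
    hpos' hpos hc₀η j₀ hJ (hj.trans (min_le_right _ _)) hposπ hQ Lw ηw lev₀ lev₁ levB
  have hw₀ : 0 ≤ (NegSup.wSup (levWeight Lw ηw lev₀ 1) : ℝ) := (NegSup.wSup (levWeight Lw ηw lev₀ 1)).coe_nonneg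
  have hw₁ : 0 ≤ (NegSup.wSup (levWeight Lw ηw lev₁ 2) : ℝ) := (NegSup.wSup (levWeight Lw ηw lev₁ 2)).coe_nonneg
  have hmono : ∀ {B' : ℝ} (w : ℝ), 0 ≤ w → B' ≤ max BG BH →
      max ((NegSup.wSup (levWeight Lw ηw lev₀ 1) : ℝ) * (Mφ * B' * Mφ')) (NegSup.wSup (levWeight Lw ηw lev₁ 2) * (Mφ * B' * Mφ')) * w ≤
        max ((NegSup.wSup (levWeight Lw ηw lev₀ 1) : ℝ) * (Mφ * max BG BH * Mφ')) (NegSup.wSup (levWeight Lw ηw lev₁ 2) * (Mφ * max BG BH * Mφ')) * w := by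
    intro B' w hw hB'
    have h1 : Mφ * B' * Mφ' ≤ Mφ * max BG BH * Mφ' := mul_le_mul_of_nonneg_right (mul_le_mul_of_nonneg_left hB' hMφ) hMφ'
    exact mul_le_mul_of_nonneg_right (max_le_max (mul_le_mul_of_nonneg_left h1 hw₀) (mul_le_mul_of_nonneg_left h1 hw₁)) hw
  exact ⟨hG.trans (hmono _ (NegSup.wInvSup (levWeight Lw ηw lev₀ 3)).coe_nonneg (le_max_left _ _)),
    hH.trans (hmono _ (NegSup.wInvSup (levWeight Lw ηw levB 0)).coe_nonneg (le_max_right _ _))⟩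

end Literature.MathematicalPhysics.QuantumFieldTheory.Balaban1983to89.B11Eq117ChartLettersOnModel

end
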